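import Summits.ABC.IUTFork.Cor312StepNodesRecloseA

/-!
# [IUTchIII] Cor. 3.12, proof steps — the kernel DAG step nodes SOLVED FOR CONTENT and RE-CLOSED, part C:
# steps (x)–(xii) except (xi-f) (FACT-LIST rows F-2163 (x), F-2164 (xi-a), F-2165 (xi-b), F-2166 (xi-c),
# F-2167 (xi-d), F-2168 (xi-e), F-2170 (xi-g), F-2171 (xi-h), F-2172 (xii); zero FACT binders)

S. Mochizuki, *Inter-universal Teichmüller theory III*, proof of Cor. 3.12, kurims `.tex` p. 180 l. 43 – p. 186 l. 3
[Mochizuki2012; claim key, status disputed]: the quantitative spine — Kummer detachment and log-volume bookkeeping (x),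
the link as a gluing (xi-a), the output possibilities satisfying (IPL)/(SHE) (xi-b), the displayed summary and the
holomorphic hull (xi-c), the passage to real numbers (xi-d), (SHE) as a fixed value (xi-e), the "two tautologically
equivalent ways" (xi-g), the absence of an `N`-th power analogue (xi-h), why global realified Frobenioids (xii). The
disputed node (xi-f) is NOT here: its row F-2169 is closed (part p `N_IUTchIII_Cor3_12_pf_xi_f_iff_statement` — at
the readings of record it IS the Corollary as typed —, part t `xi_f_not_automatic`). PROOF-ONLY companion (no
definition, no instance, no named fact; abc-iut cell, seat abc-iut-L1-d1 gen 11) of the index nodes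
`Summit.ABC.IUTFork.DAG.N_IUTchIII_Cor3_12_pf_<s>` (`DAGC312b.lean`), continuing part A (generic lemmas `stepNode_*`)
with the same name-matched one-liners per node: `_iff` (SOLVED FOR CONTENT: cited loci granted ⟹ invoked
observations ⟹ drawn observations, spelled out), `_not_automatic` + `not_forall_…` (THE UNIVERSAL CLOSURE OVER BOTH
READINGS IS REFUTED; the schema is not a theorem, its instance forms are the content), `forall_obs_…_iff` /
`forall_loci_…_iff` (the two partial closures DECIDED), and the instances at the Scholze–Stix identified-copies
reading `Cor312.Setting.identifiedObs` ([ScholzeStix2018] §2.2): ZERO binders for (xi-b), (xi-h), (xii) (no contentful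
conclusion, `Cor312.identifiedContentful`), one DATA binder `P.IdentifiedReading` for (x), (xi-a), (xi-c), (xi-d),
(xi-e), (xi-g) (R-1's collapse `identifiedObs_holds`). At the reading of record `DAG.obsReadingA` these nodes are
part p's `…_holds` / `…_holds_of` (sixteen outright, (x), (xi-a), (xi-d) under named side data) — not restated; at
TEAM A's honest reading they are `Cor312Proof.honest_chain` under its named hypotheses — not restated.

HONEST FRAMING. A step node is an INFERENCE of a disputed text under explicit readings; "re-closed" = OUR kernel
theorems about that inference with no assumption-class binder. SOLVING a node for its content locates what it asserts;
it does not grant it: whether the contentful observations of (x)–(xi-e) hold at a genuine setting is the business of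
the readings (TEAM A rows A-1…A-4, Team R, the identified-copies census), not of this index file. Nothing here decides
(xi-f), takes a side on [IUTchIII] Cor. 3.12 or on any author (Mochizuki / Scholze–Stix), or asserts that abc is proved
or refuted; typed ≠ proved; indexed ≠ endorsed. [claim: Mochizuki2012, status: disputed]
-/

namespace Summit.ABC.IUTFork.DAG

open Cor312Proof Thm311 Literature.IUT.LogThetaLattice

variable (pending : Locus → Prop) (O : Obs → Prop) {T : ThetaIndex} {S : Situation T} (P : Cor312.Setting S)

/-! ### (x) `N_IUTchIII_Cor3_12_pf_x` — row F-2163 · p. 180 l. 43 – p. 181 l. 33 -/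

/-- (x) SOLVED FOR CONTENT: its twenty-two cited loci granted ⟹ (the six observations of (ii), (iv), (v), (ix) it
invokes ⟹ its four observations: Kummer detachment up to (Ind1)–(Ind3), log-volume invariance/inequality, log-link
compatibility, `⊗ ↦ ×` identification). [claim: Mochizuki2012, status: disputed] -/
theorem N_IUTchIII_Cor3_12_pf_x_iff :
    N_IUTchIII_Cor3_12_pf_x pending O ↔
      ((∀ c ∈ Step.x.cites, pending c) → O .unitsSubjectInd12 → O .cyclotomesInsulated →
        O .verticalShiftSolved → O .unitsRelatedContainers → O .frobeniusLikeRelatedToCoric →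
        O .fmodTranslation → O .kummerDetachmentInd123 ∧ O .logvolInvariantInequality ∧
        O .logvolLogLinkCompatible ∧ O .tensorIdentifiesMultZ) :=
  (stepNode_iff pending O .x).trans (by simp [Step.uses, Step.concl, Step.data])
/-- NOT AUTOMATIC: all loci and all observations but `kummerDetachmentInd123` granted violates the node. [folklore]
-/
theorem N_IUTchIII_Cor3_12_pf_x_not_automatic :
    ¬ N_IUTchIII_Cor3_12_pf_x (fun _ => True) (fun o => o ≠ .kummerDetachmentInd123) :=
  stepNode_not_automatic_of_mem .x _ (by decide) (by decide)
/-- ∀-CLOSURE REFUTED (schema; instance forms are the content). [folklore] -/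
theorem not_forall_N_IUTchIII_Cor3_12_pf_x :
    ¬ ∀ (pending' : Locus → Prop) (O' : Obs → Prop), N_IUTchIII_Cor3_12_pf_x pending' O' :=
  stepNode_not_forall .x
/-- Closure over observation readings: iff not all twenty-two cited loci are granted. [folklore] -/
theorem forall_obs_N_IUTchIII_Cor3_12_pf_x_iff :
    (∀ O' : Obs → Prop, N_IUTchIII_Cor3_12_pf_x pending O') ↔ ¬ ∀ c ∈ Step.x.cites, pending c :=
  stepNode_forall_obs_iff pending .x
/-- Closure over loci readings: iff the node's content implication holds for `O`. [folklore] -/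
theorem forall_loci_N_IUTchIII_Cor3_12_pf_x_iff :
    (∀ pending' : Locus → Prop, N_IUTchIII_Cor3_12_pf_x pending' O) ↔
      (O .unitsSubjectInd12 → O .cyclotomesInsulated → O .verticalShiftSolved → O .unitsRelatedContainers →
        O .frobeniusLikeRelatedToCoric → O .fmodTranslation → O .kummerDetachmentInd123 ∧
        O .logvolInvariantInequality ∧ O .logvolLogLinkCompatible ∧ O .tensorIdentifiesMultZ) :=
  (stepNode_forall_loci_iff O .x).trans (by simp [Step.uses, Step.concl, Step.data])
/-- (x) draws a contentful observation: at the identified-copies reading it holds given the identified reading of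
the setting (data binder, R-1's collapse). [folklore] -/
theorem N_IUTchIII_Cor3_12_pf_x_holds_identifiedObs_of_identifiedReading (hP : P.IdentifiedReading) :
    N_IUTchIII_Cor3_12_pf_x pending P.identifiedObs :=
  stepNode_holds_identifiedObs_of_identifiedReading pending P .x hP

/-! ### (xi-a) `N_IUTchIII_Cor3_12_pf_xi_a` — row F-2164 · p. 181 l. 34–44 -/

/-- (xi-a) SOLVED FOR CONTENT: Rmk 3.12.2 (iv), (v), (ii) granted ⟹ (observation (i) `valueGroupMapsPilots` ⟹
`linkAsGluing`). [claim: Mochizuki2012, status: disputed] -/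
theorem N_IUTchIII_Cor3_12_pf_xi_a_iff :
    N_IUTchIII_Cor3_12_pf_xi_a pending O ↔
      ((∀ c ∈ Step.xi_a.cites, pending c) → O .valueGroupMapsPilots → O .linkAsGluing) :=
  (stepNode_iff pending O .xi_a).trans (by simp [Step.uses, Step.concl, Step.data])
/-- NOT AUTOMATIC: all loci and all observations but `linkAsGluing` granted violates the node. [folklore] -/
theorem N_IUTchIII_Cor3_12_pf_xi_a_not_automatic :
    ¬ N_IUTchIII_Cor3_12_pf_xi_a (fun _ => True) (fun o => o ≠ .linkAsGluing) :=
  stepNode_not_automatic_of_mem .xi_a _ (by decide) (by decide)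
/-- ∀-CLOSURE REFUTED (schema; instance forms are the content). [folklore] -/
theorem not_forall_N_IUTchIII_Cor3_12_pf_xi_a :
    ¬ ∀ (pending' : Locus → Prop) (O' : Obs → Prop), N_IUTchIII_Cor3_12_pf_xi_a pending' O' :=
  stepNode_not_forall .xi_a
/-- Closure over observation readings: iff not all three cited loci are granted. [folklore] -/
theorem forall_obs_N_IUTchIII_Cor3_12_pf_xi_a_iff :
    (∀ O' : Obs → Prop, N_IUTchIII_Cor3_12_pf_xi_a pending O') ↔ ¬ ∀ c ∈ Step.xi_a.cites, pending c :=
  stepNode_forall_obs_iff pending .xi_a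
/-- Closure over loci readings: iff the node's content implication holds for `O`. [folklore] -/
theorem forall_loci_N_IUTchIII_Cor3_12_pf_xi_a_iff :
    (∀ pending' : Locus → Prop, N_IUTchIII_Cor3_12_pf_xi_a pending' O) ↔
      (O .valueGroupMapsPilots → O .linkAsGluing) :=
  (stepNode_forall_loci_iff O .xi_a).trans (by simp [Step.uses, Step.concl, Step.data])
/-- (xi-a) draws a contentful observation: at the identified-copies reading it holds given the identified reading of
the setting (data binder, R-1's collapse). [folklore] -/
theorem N_IUTchIII_Cor3_12_pf_xi_a_holds_identifiedObs_of_identifiedReading (hP : P.IdentifiedReading) :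
    N_IUTchIII_Cor3_12_pf_xi_a pending P.identifiedObs :=
  stepNode_holds_identifiedObs_of_identifiedReading pending P .xi_a hP

/-! ### (xi-b) `N_IUTchIII_Cor3_12_pf_xi_b` — row F-2165 · p. 181 l. 45 – p. 182 l. 24 -/

/-- (xi-b) SOLVED FOR CONTENT: its eleven cited loci (incl. (IPL), (SHE)) granted ⟹ (observations (x)
`kummerDetachmentInd123` and opening ¶ `restrictToStrips` ⟹ its three observations). [claim: Mochizuki2012, status:
disputed] -/
theorem N_IUTchIII_Cor3_12_pf_xi_b_iff :
    N_IUTchIII_Cor3_12_pf_xi_b pending O ↔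
      ((∀ c ∈ Step.xi_b.cites, pending c) → O .kummerDetachmentInd123 → O .restrictToStrips →
        O .outputSatisfiesIPLSHE ∧ O .valueGroupLinkFullPolyIso ∧ O .onlyQualitative) :=
  (stepNode_iff pending O .xi_b).trans (by simp [Step.uses, Step.concl, Step.data])
/-- NOT AUTOMATIC: all loci and all observations but `outputSatisfiesIPLSHE` granted violates the node. [folklore]
-/
theorem N_IUTchIII_Cor3_12_pf_xi_b_not_automatic :
    ¬ N_IUTchIII_Cor3_12_pf_xi_b (fun _ => True) (fun o => o ≠ .outputSatisfiesIPLSHE) :=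
  stepNode_not_automatic_of_mem .xi_b _ (by decide) (by decide)
/-- ∀-CLOSURE REFUTED (schema; instance forms are the content). [folklore] -/
theorem not_forall_N_IUTchIII_Cor3_12_pf_xi_b :
    ¬ ∀ (pending' : Locus → Prop) (O' : Obs → Prop), N_IUTchIII_Cor3_12_pf_xi_b pending' O' :=
  stepNode_not_forall .xi_b
/-- Closure over observation readings: iff not all eleven cited loci are granted. [folklore] -/
theorem forall_obs_N_IUTchIII_Cor3_12_pf_xi_b_iff :
    (∀ O' : Obs → Prop, N_IUTchIII_Cor3_12_pf_xi_b pending O') ↔ ¬ ∀ c ∈ Step.xi_b.cites, pending c :=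
  stepNode_forall_obs_iff pending .xi_b
/-- Closure over loci readings: iff the node's content implication holds for `O`. [folklore] -/
theorem forall_loci_N_IUTchIII_Cor3_12_pf_xi_b_iff :
    (∀ pending' : Locus → Prop, N_IUTchIII_Cor3_12_pf_xi_b pending' O) ↔
      (O .kummerDetachmentInd123 → O .restrictToStrips → O .outputSatisfiesIPLSHE ∧
        O .valueGroupLinkFullPolyIso ∧ O .onlyQualitative) :=
  (stepNode_forall_loci_iff O .xi_b).trans (by simp [Step.uses, Step.concl, Step.data])
/-- Zero binders at the Scholze–Stix identified-copies reading (no contentful conclusion). [folklore] -/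
theorem N_IUTchIII_Cor3_12_pf_xi_b_holds_identifiedObs : N_IUTchIII_Cor3_12_pf_xi_b pending P.identifiedObs :=
  stepNode_holds_identifiedObs pending P .xi_b (by decide)

/-! ### (xi-c) `N_IUTchIII_Cor3_12_pf_xi_c` — row F-2166 · p. 182 l. 25–46 -/

/-- (xi-c) SOLVED FOR CONTENT: (IPL), (SHE), Rmk 3.9.5 (vii), Rmk 3.12.2 (v) granted ⟹ (two observations of (xi-b) ⟹
`displayXIc` and `hullGivesVectorBundles`). [claim: Mochizuki2012, status: disputed] -/
theorem N_IUTchIII_Cor3_12_pf_xi_c_iff :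
    N_IUTchIII_Cor3_12_pf_xi_c pending O ↔
      ((∀ c ∈ Step.xi_c.cites, pending c) → O .outputSatisfiesIPLSHE → O .valueGroupLinkFullPolyIso →
        O .displayXIc ∧ O .hullGivesVectorBundles) :=
  (stepNode_iff pending O .xi_c).trans (by simp [Step.uses, Step.concl, Step.data])
/-- NOT AUTOMATIC: all loci and all observations but `displayXIc` granted violates the node. [folklore] -/
theorem N_IUTchIII_Cor3_12_pf_xi_c_not_automatic :
    ¬ N_IUTchIII_Cor3_12_pf_xi_c (fun _ => True) (fun o => o ≠ .displayXIc) :=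
  stepNode_not_automatic_of_mem .xi_c _ (by decide) (by decide)
/-- ∀-CLOSURE REFUTED (schema; instance forms are the content). [folklore] -/
theorem not_forall_N_IUTchIII_Cor3_12_pf_xi_c :
    ¬ ∀ (pending' : Locus → Prop) (O' : Obs → Prop), N_IUTchIII_Cor3_12_pf_xi_c pending' O' :=
  stepNode_not_forall .xi_c
/-- Closure over observation readings: iff not all four cited loci are granted. [folklore] -/
theorem forall_obs_N_IUTchIII_Cor3_12_pf_xi_c_iff :
    (∀ O' : Obs → Prop, N_IUTchIII_Cor3_12_pf_xi_c pending O') ↔ ¬ ∀ c ∈ Step.xi_c.cites, pending c :=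
  stepNode_forall_obs_iff pending .xi_c
/-- Closure over loci readings: iff the node's content implication holds for `O`. [folklore] -/
theorem forall_loci_N_IUTchIII_Cor3_12_pf_xi_c_iff :
    (∀ pending' : Locus → Prop, N_IUTchIII_Cor3_12_pf_xi_c pending' O) ↔
      (O .outputSatisfiesIPLSHE → O .valueGroupLinkFullPolyIso → O .displayXIc ∧ O .hullGivesVectorBundles) :=
  (stepNode_forall_loci_iff O .xi_c).trans (by simp [Step.uses, Step.concl, Step.data])
/-- (xi-c) draws a contentful observation: at the identified-copies reading it holds given the identified reading of
the setting (data binder, R-1's collapse). [folklore] -/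
theorem N_IUTchIII_Cor3_12_pf_xi_c_holds_identifiedObs_of_identifiedReading (hP : P.IdentifiedReading) :
    N_IUTchIII_Cor3_12_pf_xi_c pending P.identifiedObs :=
  stepNode_holds_identifiedObs_of_identifiedReading pending P .xi_c hP

/-! ### (xi-d) `N_IUTchIII_Cor3_12_pf_xi_d` — row F-2167 · p. 183 l. 2–42 -/

/-- (xi-d) SOLVED FOR CONTENT: its thirteen cited loci granted ⟹ (the two observations of (xi-c) ⟹ its four
observations, where the real numbers enter). [claim: Mochizuki2012, status: disputed] -/
theorem N_IUTchIII_Cor3_12_pf_xi_d_iff :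
    N_IUTchIII_Cor3_12_pf_xi_d pending O ↔
      ((∀ c ∈ Step.xi_d.cites, pending c) → O .displayXIc → O .hullGivesVectorBundles → O .displayXId ∧
        O .comparableObjects ∧ O .degreesAsLogVolumes ∧ O .oneColumnLogKummerRectifies) :=
  (stepNode_iff pending O .xi_d).trans (by simp [Step.uses, Step.concl, Step.data])
/-- NOT AUTOMATIC: all loci and all observations but `displayXId` granted violates the node. [folklore] -/
theorem N_IUTchIII_Cor3_12_pf_xi_d_not_automatic :
    ¬ N_IUTchIII_Cor3_12_pf_xi_d (fun _ => True) (fun o => o ≠ .displayXId) :=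
  stepNode_not_automatic_of_mem .xi_d _ (by decide) (by decide)
/-- ∀-CLOSURE REFUTED (schema; instance forms are the content). [folklore] -/
theorem not_forall_N_IUTchIII_Cor3_12_pf_xi_d :
    ¬ ∀ (pending' : Locus → Prop) (O' : Obs → Prop), N_IUTchIII_Cor3_12_pf_xi_d pending' O' :=
  stepNode_not_forall .xi_d
/-- Closure over observation readings: iff not all thirteen cited loci are granted. [folklore] -/
theorem forall_obs_N_IUTchIII_Cor3_12_pf_xi_d_iff :
    (∀ O' : Obs → Prop, N_IUTchIII_Cor3_12_pf_xi_d pending O') ↔ ¬ ∀ c ∈ Step.xi_d.cites, pending c :=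
  stepNode_forall_obs_iff pending .xi_d
/-- Closure over loci readings: iff the node's content implication holds for `O`. [folklore] -/
theorem forall_loci_N_IUTchIII_Cor3_12_pf_xi_d_iff :
    (∀ pending' : Locus → Prop, N_IUTchIII_Cor3_12_pf_xi_d pending' O) ↔
      (O .displayXIc → O .hullGivesVectorBundles → O .displayXId ∧ O .comparableObjects ∧
        O .degreesAsLogVolumes ∧ O .oneColumnLogKummerRectifies) :=
  (stepNode_forall_loci_iff O .xi_d).trans (by simp [Step.uses, Step.concl, Step.data])
/-- (xi-d) draws a contentful observation: at the identified-copies reading it holds given the identified reading of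
the setting (data binder, R-1's collapse). [folklore] -/
theorem N_IUTchIII_Cor3_12_pf_xi_d_holds_identifiedObs_of_identifiedReading (hP : P.IdentifiedReading) :
    N_IUTchIII_Cor3_12_pf_xi_d pending P.identifiedObs :=
  stepNode_holds_identifiedObs_of_identifiedReading pending P .xi_d hP

/-! ### (xi-e) `N_IUTchIII_Cor3_12_pf_xi_e` — row F-2168 · p. 183 l. 43 – p. 184 l. 18 -/

/-- (xi-e) SOLVED FOR CONTENT: (SHE), (IPL), the Thm-3.11 algorithm locus granted ⟹ (observations `displayXId`,
`comparableObjects` of (xi-d) ⟹ `sheMeansFixedValue` and `displayXIe`). [claim: Mochizuki2012, status: disputed] -/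
theorem N_IUTchIII_Cor3_12_pf_xi_e_iff :
    N_IUTchIII_Cor3_12_pf_xi_e pending O ↔
      ((∀ c ∈ Step.xi_e.cites, pending c) → O .displayXId → O .comparableObjects → O .sheMeansFixedValue ∧
        O .displayXIe) :=
  (stepNode_iff pending O .xi_e).trans (by simp [Step.uses, Step.concl, Step.data])
/-- NOT AUTOMATIC: all loci and all observations but `sheMeansFixedValue` granted violates the node. [folklore] -/
theorem N_IUTchIII_Cor3_12_pf_xi_e_not_automatic :
    ¬ N_IUTchIII_Cor3_12_pf_xi_e (fun _ => True) (fun o => o ≠ .sheMeansFixedValue) :=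
  stepNode_not_automatic_of_mem .xi_e _ (by decide) (by decide)
/-- ∀-CLOSURE REFUTED (schema; instance forms are the content). [folklore] -/
theorem not_forall_N_IUTchIII_Cor3_12_pf_xi_e :
    ¬ ∀ (pending' : Locus → Prop) (O' : Obs → Prop), N_IUTchIII_Cor3_12_pf_xi_e pending' O' :=
  stepNode_not_forall .xi_e
/-- Closure over observation readings: iff not all three cited loci are granted. [folklore] -/
theorem forall_obs_N_IUTchIII_Cor3_12_pf_xi_e_iff :
    (∀ O' : Obs → Prop, N_IUTchIII_Cor3_12_pf_xi_e pending O') ↔ ¬ ∀ c ∈ Step.xi_e.cites, pending c :=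
  stepNode_forall_obs_iff pending .xi_e
/-- Closure over loci readings: iff the node's content implication holds for `O`. [folklore] -/
theorem forall_loci_N_IUTchIII_Cor3_12_pf_xi_e_iff :
    (∀ pending' : Locus → Prop, N_IUTchIII_Cor3_12_pf_xi_e pending' O) ↔
      (O .displayXId → O .comparableObjects → O .sheMeansFixedValue ∧ O .displayXIe) :=
  (stepNode_forall_loci_iff O .xi_e).trans (by simp [Step.uses, Step.concl, Step.data])
/-- (xi-e) draws a contentful observation: at the identified-copies reading it holds given the identified reading of
the setting (data binder, R-1's collapse). [folklore] -/
theorem N_IUTchIII_Cor3_12_pf_xi_e_holds_identifiedObs_of_identifiedReading (hP : P.IdentifiedReading) :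
    N_IUTchIII_Cor3_12_pf_xi_e pending P.identifiedObs :=
  stepNode_holds_identifiedObs_of_identifiedReading pending P .xi_e hP

/-! ### (xi-g) `N_IUTchIII_Cor3_12_pf_xi_g` — row F-2170 · p. 184 l. 30–34 -/

/-- (xi-g) SOLVED FOR CONTENT: the Thm-3.11 algorithm locus granted ⟹ ((xi-f)'s `constitutesConstruction` ⟹
`twoEquivalentWays`). [claim: Mochizuki2012, status: disputed] -/
theorem N_IUTchIII_Cor3_12_pf_xi_g_iff :
    N_IUTchIII_Cor3_12_pf_xi_g pending O ↔
      ((∀ c ∈ Step.xi_g.cites, pending c) → O .constitutesConstruction → O .twoEquivalentWays) :=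
  (stepNode_iff pending O .xi_g).trans (by simp [Step.uses, Step.concl, Step.data])
/-- NOT AUTOMATIC: all loci and all observations but `twoEquivalentWays` granted violates the node. [folklore] -/
theorem N_IUTchIII_Cor3_12_pf_xi_g_not_automatic :
    ¬ N_IUTchIII_Cor3_12_pf_xi_g (fun _ => True) (fun o => o ≠ .twoEquivalentWays) :=
  stepNode_not_automatic_of_mem .xi_g _ (by decide) (by decide)
/-- ∀-CLOSURE REFUTED (schema; instance forms are the content). [folklore] -/
theorem not_forall_N_IUTchIII_Cor3_12_pf_xi_g :
    ¬ ∀ (pending' : Locus → Prop) (O' : Obs → Prop), N_IUTchIII_Cor3_12_pf_xi_g pending' O' :=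
  stepNode_not_forall .xi_g
/-- Closure over observation readings: iff the one cited locus is not granted. [folklore] -/
theorem forall_obs_N_IUTchIII_Cor3_12_pf_xi_g_iff :
    (∀ O' : Obs → Prop, N_IUTchIII_Cor3_12_pf_xi_g pending O') ↔ ¬ ∀ c ∈ Step.xi_g.cites, pending c :=
  stepNode_forall_obs_iff pending .xi_g
/-- Closure over loci readings: iff the node's content implication holds for `O`. [folklore] -/
theorem forall_loci_N_IUTchIII_Cor3_12_pf_xi_g_iff :
    (∀ pending' : Locus → Prop, N_IUTchIII_Cor3_12_pf_xi_g pending' O) ↔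
      (O .constitutesConstruction → O .twoEquivalentWays) :=
  (stepNode_forall_loci_iff O .xi_g).trans (by simp [Step.uses, Step.concl, Step.data])
/-- (xi-g) draws a contentful observation: at the identified-copies reading it holds given the identified reading of
the setting (data binder, R-1's collapse). [folklore] -/
theorem N_IUTchIII_Cor3_12_pf_xi_g_holds_identifiedObs_of_identifiedReading (hP : P.IdentifiedReading) :
    N_IUTchIII_Cor3_12_pf_xi_g pending P.identifiedObs :=
  stepNode_holds_identifiedObs_of_identifiedReading pending P .xi_g hP

/-! ### (xi-h) `N_IUTchIII_Cor3_12_pf_xi_h` — row F-2171 · p. 185 l. 48–58 -/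

/-- (xi-h) SOLVED FOR CONTENT: [EtTh], Rmk 2.1.1, [IUTchII] Rmk 3.6.4, [IUTchIV] Rmk 2.3.2 (ii) granted ⟹
(observations (ii) `cyclotomesInsulated` and (vi) `logKummerViaGaloisEvaluation` ⟹ `noNthPower`). [claim:
Mochizuki2012, status: disputed] -/
theorem N_IUTchIII_Cor3_12_pf_xi_h_iff :
    N_IUTchIII_Cor3_12_pf_xi_h pending O ↔
      ((∀ c ∈ Step.xi_h.cites, pending c) → O .cyclotomesInsulated → O .logKummerViaGaloisEvaluation →
        O .noNthPower) :=
  (stepNode_iff pending O .xi_h).trans (by simp [Step.uses, Step.concl, Step.data])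
/-- NOT AUTOMATIC: all loci and all observations but `noNthPower` granted violates the node. [folklore] -/
theorem N_IUTchIII_Cor3_12_pf_xi_h_not_automatic :
    ¬ N_IUTchIII_Cor3_12_pf_xi_h (fun _ => True) (fun o => o ≠ .noNthPower) :=
  stepNode_not_automatic_of_mem .xi_h _ (by decide) (by decide)
/-- ∀-CLOSURE REFUTED (schema; instance forms are the content). [folklore] -/
theorem not_forall_N_IUTchIII_Cor3_12_pf_xi_h :
    ¬ ∀ (pending' : Locus → Prop) (O' : Obs → Prop), N_IUTchIII_Cor3_12_pf_xi_h pending' O' :=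
  stepNode_not_forall .xi_h
/-- Closure over observation readings: iff not all four cited loci are granted. [folklore] -/
theorem forall_obs_N_IUTchIII_Cor3_12_pf_xi_h_iff :
    (∀ O' : Obs → Prop, N_IUTchIII_Cor3_12_pf_xi_h pending O') ↔ ¬ ∀ c ∈ Step.xi_h.cites, pending c :=
  stepNode_forall_obs_iff pending .xi_h
/-- Closure over loci readings: iff the node's content implication holds for `O`. [folklore] -/
theorem forall_loci_N_IUTchIII_Cor3_12_pf_xi_h_iff :
    (∀ pending' : Locus → Prop, N_IUTchIII_Cor3_12_pf_xi_h pending' O) ↔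
      (O .cyclotomesInsulated → O .logKummerViaGaloisEvaluation → O .noNthPower) :=
  (stepNode_forall_loci_iff O .xi_h).trans (by simp [Step.uses, Step.concl, Step.data])
/-- Zero binders at the Scholze–Stix identified-copies reading (no contentful conclusion). [folklore] -/
theorem N_IUTchIII_Cor3_12_pf_xi_h_holds_identifiedObs : N_IUTchIII_Cor3_12_pf_xi_h pending P.identifiedObs :=
  stepNode_holds_identifiedObs pending P .xi_h (by decide)

/-! ### (xii) `N_IUTchIII_Cor3_12_pf_xii` — row F-2172 · p. 185 l. 59 – p. 186 l. 3 -/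

/-- (xii) SOLVED FOR CONTENT: Rmk 3.6.2 (i) granted ⟹ `globalFrobenioidsNeeded` granted (invokes nothing). [claim:
Mochizuki2012, status: disputed] -/
theorem N_IUTchIII_Cor3_12_pf_xii_iff :
    N_IUTchIII_Cor3_12_pf_xii pending O ↔
      ((∀ c ∈ Step.xii.cites, pending c) → O .globalFrobenioidsNeeded) :=
  (stepNode_iff pending O .xii).trans (by simp [Step.uses, Step.concl, Step.data])
/-- NOT AUTOMATIC: all loci and all observations but `globalFrobenioidsNeeded` granted violates the node. [folklore]
-/
theorem N_IUTchIII_Cor3_12_pf_xii_not_automatic :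
    ¬ N_IUTchIII_Cor3_12_pf_xii (fun _ => True) (fun o => o ≠ .globalFrobenioidsNeeded) :=
  stepNode_not_automatic_of_mem .xii _ (by decide) (by decide)
/-- ∀-CLOSURE REFUTED (schema; instance forms are the content). [folklore] -/
theorem not_forall_N_IUTchIII_Cor3_12_pf_xii :
    ¬ ∀ (pending' : Locus → Prop) (O' : Obs → Prop), N_IUTchIII_Cor3_12_pf_xii pending' O' :=
  stepNode_not_forall .xii
/-- Closure over observation readings: iff the one cited locus is not granted. [folklore] -/
theorem forall_obs_N_IUTchIII_Cor3_12_pf_xii_iff :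
    (∀ O' : Obs → Prop, N_IUTchIII_Cor3_12_pf_xii pending O') ↔ ¬ ∀ c ∈ Step.xii.cites, pending c :=
  stepNode_forall_obs_iff pending .xii
/-- Closure over loci readings: iff the node's content implication holds for `O`. [folklore] -/
theorem forall_loci_N_IUTchIII_Cor3_12_pf_xii_iff :
    (∀ pending' : Locus → Prop, N_IUTchIII_Cor3_12_pf_xii pending' O) ↔
      (O .globalFrobenioidsNeeded) :=
  (stepNode_forall_loci_iff O .xii).trans (by simp [Step.uses, Step.concl, Step.data])
/-- Zero binders at the Scholze–Stix identified-copies reading (no contentful conclusion). [folklore] -/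
theorem N_IUTchIII_Cor3_12_pf_xii_holds_identifiedObs : N_IUTchIII_Cor3_12_pf_xii pending P.identifiedObs :=
  stepNode_holds_identifiedObs pending P .xii (by decide)

end Summit.ABC.IUTFork.DAG
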